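import Literature.Geometry.Lorentzian.KerrDeSitterTeukolskyRadial
import HarnessLib
import HarnessLib.Audit.Tags

/-!
# Venture KdS — Conjectures/AngularDrift.lean: the MATHEMATICAL SHADOW of structure conjecture C2′, TYPED
# (first-order drift law of the angular eigenvalue with explicit constants) — `AngularDriftBound`

HONEST FRAMING (venture `Summits/Ventures/KdS`, cell `pub-kds`): validated-numerics mode stability for Kerr–de Sitter, box by
box. This file ASSERTS NOTHING: it types one open, falsifiable statement about the angular eigenvalues of the tree's predicate
`IsAngularEigenvalue` (Hatsuda 2020 (2.5) normalisation, `λ|_{a=0} = l(l+1) − s(s−1)`) as an `@[conjecture] def … : Prop` with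
every constant printed — no proof, no `sorry`, no axiom, no cited Literature fact. Lead ruling A90 (i) (2026-08-23T03:37Z):
C2′ itself («first-pass argument-principle COUNT fails iff ĉ ≥ ĉ*») quantifies over engine first passes and stays a COST LAW in
HOME/STRUCTURE.md §2/§6; coordinator rule (5) for C2′ is discharged by typing this shadow instead (HOME/theory/C2-DRIFT.md).

THE LAW (theory/C2-DRIFT.md §1). The angular equation depends on `ω` only through `c = aω`; its `c`-linear terms are
`−2csx + 2cm` (up to `O(α)`, `α = Λa²/3`), and `⟨ₛY_lm| x |ₛY_lm⟩ = −sm/(l(l+1))`, so on the `(s, l, m)` branch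
    λ_H(c) = E_l − 2mc·[1 + s²/(l(l+1))] + D_l·c² + O(c³) + O(α),      E_l := l(l+1) − s(s−1),
with `D_l = h(l+1) − h(l)`, `h(l) = (l² − m²)(l² − s²)²/(2(l − ½)(l + ½)l³)` (`h := 0` where the formula degenerates) — the
textbook small-`aω` expansion of the spin-weighted spheroidal eigenvalue (Press–Teukolsky 1973; Seidel 1989; Berti–Cardoso–Casals
2006 §II: `ₛA_lm = l(l+1) − s(s+1) − 2ms²c/(l(l+1)) + [h(l+1) − h(l) − 1]c² + …`) pushed through the normalisation map
`λ_H = ₛA_lm + 2s + c² − 2mc` read off `angularPotential` at `α = 0`. Drift rates `2m[1 + s²/(l(l+1))]` for the census runs: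
`(s, m) = (−2, 2)`: 20/3, 16/3, 24/5 (`l = 2, 3, 4`); `(−2, 1)`: 10/3, 8/3, 12/5; `(0, 2)`: 4; `(0, 1)`: 2; `m = 0`: 0. Second-order
coefficients `|D_l| ≤ 0.86` on all 18 triples below (largest: `(0, 2, 2)`: 6/7; `(−2, 2, 2)`: 0.265).

WHAT IS TYPED. For `s ∈ {−2, 0}`, `m ∈ {0, 1, 2}`, `l ∈ {l_min, l_min + 1, l_min + 2}` (`l_min = max(|m|, |s|)`), `0 ≤ a`, `0 ≤ Λ`,
`α = Λa²/3 ≤ 1/50`, `|c| ≤ 3/10` (`c = aω`, complex — every wave-2 covering disc has `|c| ≤ 0.28`): every angular eigenvalue `λ` in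
eng-1's registered count square `Λ□(l) = [E_l ± (l + ½)]²` satisfies
    ‖λ − E_l + 2m[1 + s²/(l(l+1))]·c‖ ≤ K·‖c‖² + A_l·α,     K := 2 (= 2 × max |D_l| rounded up),  A_l := 2(|s| + 2 + 4|sm| + 2l(l+1))
(`A_l` = a crude ×2 bound on `|∂_α λ|` at `α = 0` from `angularPotential`: `|s − 2x² + 4smx − (2 − x²)(m + sx)²/(1 − x²)|` in expectation,
using `⟨(m+sx)²/(1−x²)⟩ ≤ l(l+1) − s²`; it only matters on the high-`λ̂` rows, `α ≤ 0.013` on wave 2). The `m = 0` junk value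
`s²/(l(l+1))` at `l = 0` never matters (the coefficient carries the factor `m`).

EVIDENCE LEDGER (HOME files; nothing here is a Lean fact): REF g19 02:44–02:51Z measured eng-1's `(s, m, l) = (−2, 2, 2)` cluster tube on
W2k3_r041/r045_c029 (`ĉ = 0.279`, `a = 0.772`, disc centre `0.115i`): centre `≈ 0.18 − 0.60i`, half-width `2.05–2.07`, lower `Im` reach
`−2.67`; the law predicts centre offset `−(20/3)·0.772·0.115 i = −0.59i`, first-order radius `(20/3)·0.279 = 1.86` (⇒ Taylor-model
inflation 1.10), reach `−2.64` — no parameter fitted (theory/C2-DRIFT.md). It explains C2′'s fragility order `(2,2) ≺ (2,3) ≺ (2,4)`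
(rate/half-side `2.67 > 1.52 > 1.07`), why `m ≤ 1` and `m = 0` never fail, why quadrant counts rescue `(2,2)`. Pre-registered seat calls
adopted by the lead (A90 (ii)): P-C2D.1 (whole-disc `(2,2)` G1 link flips in `ĉ ∈ (0.25, 0.27)`), P-C2D.2 (`(2,3)` first-pass failures are
not hull exits). WHAT WOULD REFUTE IT: one certified angular-eigenvalue enclosure (eng-1's parametric-Krawczyk balls `λ̂_l(ω, a, Λ) ± e_λ`,
any filed record) outside the stated ball for some `|c| ≤ 3/10`, `α ≤ 1/50`. WHAT WOULD PROVE IT: analytic perturbation theory for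
the (non-self-adjoint at complex `c`) angular pencil with explicit resolvent bounds — L-sized, not in the tree (typing S, proof L; bus
03:37Z). NOT CLAIMED: anything about modes, windings or certificates; the `O(c³)` constant beyond `K = 2`'s safety margin.
-/

noncomputable section

namespace Summit.Ventures.KdS.Conjectures

open Literature.Geometry.Lorentzian Literature.Geometry.Lorentzian.KerrDeSitter

/-- `E_l(s) = l(l+1) − s(s−1)`: the angular eigenvalue at `a = 0` in Hatsuda's normalisation (centre of eng-1's count square `Λ□(l)`). -/
def hatsudaE (s : ℝ) (l : ℕ) : ℝ := (l : ℝ) * (l + 1) - s * (s - 1)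

/-- First-order drift coefficient `2m[1 + s²/(l(l+1))]` of `λ_H` in `c = aω` (theory/C2-DRIFT.md §1); `0` whenever `m = 0`. -/
def driftCoeff (s m : ℝ) (l : ℕ) : ℝ := 2 * m * (1 + s ^ 2 / ((l : ℝ) * (l + 1)))

/-- Second-order safety constant `K = 2` (twice the largest `|D_l| = |h(l+1) − h(l)| ≤ 0.86` over the 18 census triples, rounded up). -/
def driftK : ℝ := 2

/-- `α`-allowance `A_l = 2(|s| + 2 + 4|sm| + 2l(l+1))`: a crude doubled bound on `|∂λ/∂α|` at `α = 0` (module docstring). -/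
def alphaAllowance (s m : ℝ) (l : ℕ) : ℝ := 2 * (|s| + 2 + 4 * |s * m| + 2 * (l : ℝ) * (l + 1))

/-- The census spins, azimuthal numbers and clusters: `s ∈ {−2, 0}`, `m ∈ {0, 1, 2}`, `l_min ≤ l ≤ l_min + 2`, `l_min = max(|m|, |s|)`. -/
def CensusTriple (s m : ℝ) (l : ℕ) : Prop :=
  (s = -2 ∨ s = 0) ∧ (m = 0 ∨ m = 1 ∨ m = 2) ∧ max |m| |s| ≤ (l : ℝ) ∧ (l : ℝ) ≤ max |m| |s| + 2

/-- **ANGULAR DRIFT BOUND — the typed mathematical shadow of structure conjecture C2′ (lead ruling A90 (i)).** For every census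
triple `(s, m, l)`, every `0 ≤ a`, `0 ≤ Λ` with `α = Λa²/3 ≤ 1/50`, every complex `ω` with `‖aω‖ ≤ 3/10`, and every angular eigenvalue
`λ` (tree predicate `IsAngularEigenvalue`, Hatsuda normalisation) lying in the count square `|Re(λ − E_l)|, |Im(λ − E_l)| ≤ l + ½`:
`‖λ − E_l + 2m[1 + s²/(l(l+1))]·(aω)‖ ≤ 2·‖aω‖² + A_l·α`. OPEN; constants, evidence and falsifier in the module docstring
(HOME/theory/C2-DRIFT.md; STRUCTURE.md §2/§6 C2′; PLAN §11 A90). Not a certificate, not a theorem. -/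
@[conjecture] def AngularDriftBound : Prop :=
  ∀ (a Λ s m : ℝ) (l : ℕ) (ω lam : ℂ), CensusTriple s m l → 0 ≤ a → 0 ≤ Λ → alpha a Λ ≤ 1 / 50 →
    ‖(a : ℂ) * ω‖ ≤ 3 / 10 → IsAngularEigenvalue a Λ s ω m lam →
    |(lam - hatsudaE s l).re| ≤ (l : ℝ) + 1 / 2 → |(lam - hatsudaE s l).im| ≤ (l : ℝ) + 1 / 2 →
    ‖lam - hatsudaE s l + (driftCoeff s m l : ℂ) * ((a : ℂ) * ω)‖ ≤
      driftK * ‖(a : ℂ) * ω‖ ^ 2 + alphaAllowance s m l * alpha a Λ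

/-! ### Cheap honest wiring: the printed constants (for the referee's cross-check against theory/C2-DRIFT.md) -/

/-- No first-order drift for `m = 0` (the census's cheapest runs, r3: 300–320 cells everywhere). -/
theorem driftCoeff_m_zero (s : ℝ) (l : ℕ) : driftCoeff s 0 l = 0 := by simp [driftCoeff]

/-- The six drift rates of the `s = −2` census runs r1/r2 (`m = 2, 1`; `l = 2, 3, 4`): `20/3, 16/3, 24/5` and `10/3, 8/3, 12/5`. -/
theorem driftCoeff_spinTwo :
    driftCoeff (-2) 2 2 = 20 / 3 ∧ driftCoeff (-2) 2 3 = 16 / 3 ∧ driftCoeff (-2) 2 4 = 24 / 5 ∧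
      driftCoeff (-2) 1 2 = 10 / 3 ∧ driftCoeff (-2) 1 3 = 8 / 3 ∧ driftCoeff (-2) 1 4 = 12 / 5 := by
  refine ⟨?_, ?_, ?_, ?_, ?_, ?_⟩ <;> norm_num [driftCoeff]

/-- The scalar (`s = 0`, `μ = 1`) runs r7/r8 drift at the `l`-independent rates `2m`: `4` for `m = 2`, `2` for `m = 1`. -/
theorem driftCoeff_scalar (l : ℕ) : driftCoeff 0 2 l = 4 ∧ driftCoeff 0 1 l = 2 := by
  constructor <;> norm_num [driftCoeff]

/-- Centres of eng-1's count squares: `E_l(−2) = 0, 6, 14` and `E_l(0) = 6, 12, 20` for `l = 2, 3, 4`; `E_1(0) = 2`. -/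
theorem hatsudaE_values :
    hatsudaE (-2) 2 = 0 ∧ hatsudaE (-2) 3 = 6 ∧ hatsudaE (-2) 4 = 14 ∧
      hatsudaE 0 1 = 2 ∧ hatsudaE 0 2 = 6 ∧ hatsudaE 0 3 = 12 ∧ hatsudaE 0 4 = 20 := by
  refine ⟨?_, ?_, ?_, ?_, ?_, ?_, ?_⟩ <;> norm_num [hatsudaE]

end Summit.Ventures.KdS.Conjectures

end
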